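import Literature.MathematicalPhysics.QuantumFieldTheory.Balaban1983to89.B6DomainMajorant

/-!
# `Balaban1983to89.B6DomainChangeP2134` — T. Bałaban, *Propagators and renormalization transformations for lattice gauge theories. II*,
# Commun. Math. Phys. **96** (1984) 223–250 [Balaban1984PropagatorsII], p. 239 (2.92) line 3 `ζ_□(∂P∂* − ∂P_□∂*)h_□` and p. 238 *"the usual estimate
# of the type (1.12) [3] connected with a change of a domain"*: THE CHANGE OF DOMAIN FOR THE PROJECTION `P = G′Q′*(Q′G′²Q′*)⁻¹Q′G′` OF (2.17) —
# THE ALGEBRA: the cut difference `c_L·(P − P_□)·c_R` EXPANDED INTO TERMS EACH CARRYING A FACTOR LOCALISED IN THE ZONE where the cutoff `χ` varies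
# (`[χ, Δ′_a]·G′`, `[χ, Δ′_a]·G′_□`) or is not `1` (`1 − χ`), in any ring — the skeleton the block-majorant estimate of line 3 of (2.92) is assembled on

statement-level skeleton of published theorems with citation tags; proofs where landed; nothing here is a claim about the Yang–Mills mass gap

PDF held: `paper:balaban1984-cmp96-propagators-rt-ii` (journal page = PDF page + 222); p. 225 [PDF 3] ((2.17)), p. 238 [PDF 16], p. 239 [PDF 17] ((2.90)–(2.92)) — read from
the tree transcriptions of `…B6DomainMajorant` (b06; p. 238 re-read there), `…B6Eq291Generator` (p02; p. 239 re-read as an image there), `…B6Ineq288MultiLevelBox`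
(P7; (2.17)).  PRINT: p. 225 (2.17)–(2.18) *"R = I − G′Q′*(Q′G′²Q′*)⁻¹Q′G′ = I − P"*; p. 239 *"Let us denote by P_□ the projection operator in (2.17) defined by
the above Q′*aQ′, and G_□ = (Δ − ∂P_□∂* + Q*aQ)⁻¹. (2.90) … (K_{□,□}A)_μ(x) = … + (ζ_□(∂P∂* − ∂P_□∂*)h_□A)_μ(x) + … (2.92)"*; p. 238 *"the operator with
G′(□̃)² − G′² is small and an estimate has the factor e^{−δ₀M} because of the usual estimate of the type (1.12) [3] connected with a change of a domain. This
estimate follows from the random walk representations (2.50) for the operators G′, G′(□̃)."*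

CITATION HEADER (lean-in-tree rule) — WHAT IS REPRODUCED.  Phase-2 file of the `lit-balaban` typed skeleton (HOME `run/shared/lean/pub/lit-balaban/`), seat
**p38 gen 25**; owner-named bite **(d4)** of B6-CLOSURE §5 item 7 (r03 g18, 2026-08-22T22:18Z: *"(d4) … ζ_□(∂P∂* − ∂P_□∂*)h_□ = DOMAIN-CHANGE estimate P vs
P_□ near □ (NEW analytic input …)"*); cell GAPS G-B6-p38-02; SKELETON rows **B6.Eq2.91** ((2.92) line 3) × **B6.Eq2.134** × **B6.Eq2.17** (cells only; decls
of record untouched; referee ref-4).  The consumer is the displayed hypothesis `hD` of `…B6Ineq2134Diag.diag_hasMajorant` / `…B6Ineq2134DiagKLevel.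
ineq2134_kDiag_kLevel(_theta)` / `…B6Ineq2134KFamKLevel.h2134_kFam_kLevel` (a majorant `C_De^{−c_DM}(L^jη)^{−2}e^{−δd}` of `ζ_□(∂P∂* − ∂P_□∂*)h_□`).  The tree's
`…B6DomainMajorant` (b06) certifies the p. 238 mechanism for ONE inverse and for the SQUARE `G′(□̃)² − G′²` (`cut_localInverse`, `localInverse_cut`,
`core_sq_sub_sq`, `line3_core_majorant`, `line3_deep_majorant`).  THIS FILE supplies the ALGEBRA for the five-factor projection, in any ring, with
`G`/`Gw` = the global/□-local scalar propagators `G′`/`G′_□` (inverses of `D = Δ′_a` globally / against the cutoff: `GD = DG = 1`, `χ·D·Gw = χ`, `Gw·D·χ = χ`,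
b06's `cutHyp_left/right`), `Q`/`Qt` = `Q′`/`Q′*`, `C`/`Cw` = `(Q′G′²Q′*)⁻¹` / `(Q′G′_□²Q′*)⁻¹` (`Q′G′²Q′*·C = 1`;
`G′_□Q′*·C_□·Q′G′_□²Q′* = G′_□Q′*` — the local one inverts only on the window's blocks, which is all `G′_□Q′*` sees), `χ` the cutoff, `K := [χ, D] =
χD − Dχ` (localised where `χ` varies), `cL`/`cR` the outer factors (`ζ_□∂`, `∂*h_□`: `cL·χ = cL`, `χ·cR = cR`):
* §1 `cut_comm_global` (`χG − Gχ = −G·K·G`), `cut_diff_left` (`χ(G − Gw) = G·K·(Gw − G)`), `diff_cut_right` (`(G − Gw)χ = (G − Gw)·K·G`), `inv_sub_inv`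
  (`U(C − Cw) = U·Cw·(Bw − B)·C`), `proj_telescope` (`P − P_□` = three terms with ONE difference each), `sq_sub_sq_split`, `diff_zone_left` / `diff_zone_right`
  (`Gw − G = G·K·(G − Gw) + (1 − χ)(Gw − G) = (Gw − G)·K·G + (Gw − G)(1 − χ)` — WITHOUT cuts: the cutoff itself localises the difference);
* §2 **`domainChangeP_expand`**: `cL·(P − P_□)·cR` = the term through `(G − Gw)` on the left (`cL·G·K·(Gw − G)·Q′*CQ′G·cR`) + the middle term through
  `C − Cw = Cw·Q′(G_□′² − G′²)Q′*·C` with `G_□′² − G′²` split and each difference re-expressed by `diff_zone_left/right` + the term through `(G − Gw)` on the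
  right — SIX summands, EACH containing `K·G`, `K·Gw`, `K·(G − Gw)` or `(1 − χ)` (the zone-localised factors whose block majorants carry the *"factor
  e^{−δ₀M}"* once the cuts sit at depth `~M` from the zone, `…B6DomainMajorant.line3_deep_majorant`'s mechanism).
* §3 `domainChangeP_hasMajorant` / `domainChangeP_hasMajorant6`: the same in the (2.51)/(2.64) block-majorant language (`B6RandomWalk.HasMajorant`) —
  majorants of the four / six summands add up to a majorant of `cL·(P − P_□)·cR` (the shape the consumer's `hD` is fed).
* §4 (v1.1, gen 27) THE SANDWICH FORM, ONE RING: the coarse-lattice operators enter only through the SITE operators `S := Q′*CQ′`, `S_□ := Q′*C_□Q′`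
  (so a consumer whose `Q′` is rectangular — sites → `𝔅` — instantiates in `End(X_sites)`), `P = G′SG′`, `P_□ = G′_□S_□G′_□`, with the inverse
  hypotheses WEAKENED to `hS1 : S_□·G′²·S = S_□` (`sandwich_hyp_global`: a consequence of `Q′G′²Q′*·C = 1`) and `hS2 : G′_□S_□·G′_□²·S = G′_□S`
  (`sandwich_hyp_local`: a consequence of the member inverse seen from `G′_□Q′*`): `sandwich_sub` (`G′_□(S − S_□) = G′_□S_□(G′_□² − G′²)S`),
  `proj_telescope_sandwich`, `domainChangeP_expand6_sandwich` (the six summands of §2 verbatim with `Q′*CQ′G′ ↦ SG′`, `G′_□Q′*C_□Q′ ↦ G′_□S_□`),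
  and the LEFT-ZONE SEVEN-TERM form **`domainChangeP_expand7_left`**: `cL·(P − P_□)` expanded with EVERY difference re-expressed by `diff_zone_left`
  — each summand carries `[χ, Δ′_a]·G′`, `[χ, Δ′_a]·G′_□` (the zone where `χ` varies, entered from the LEFT) or `1 − χ`; it needs ONLY the left cut
  (`cL·χ = cL`) and ONLY `χΔ′_aG′_□ = χ` (no right cut, no `G′_□Δ′_aχ = χ`) — the form the block-majorant sizes are assembled on
  (`…B6DomainChangeP2134Sizes`, where only LEFT zone kernels `1_N(y)θe^{−δd}` are displayed inputs); `domainChangeP_hasMajorant7_left`.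
No `def`, no new hypothesis-fact; standard axioms; pure ring algebra (`noncomm_ring` + the two b06 identities BY NAME) + `hasMajorant_add`.
HONEST SCOPE / DIVERGENCES. (1) Algebra only: the block-majorant assembly (weights `(L^jη)^{±2}`, (2.60) scale transfer, (2.61)/(2.63) sums, the depth
of the cuts) is NOT done here — it is the second half of bite (d4), to be fired on the concrete `P`, `P_□` of B6-CLOSURE item 7 (d1)/(d3) (global `k`-level
`P` = P7's `pM`/(ROUTE V) V1's `RE`; `P_□` = the two-scale member's projection through r03's transplant p342390); the derivative factors `∂`, `∂*` of line 3
are inside the abstract `cL`, `cR`. (2) The hypothesis shapes `χ·D·Gw = χ`, `Gw·D·χ = χ` are b06's (restriction-type local inverse, p. 228 *"G(Ω) =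
(Δ_a↾_Ω)⁻¹"*); `Q′`, `Q′*` are the SAME for the global and the local operator (block averaging is local — p. 239 *"P_□ … defined by the above Q′*aQ′"*).
(3) Print derives the smallness *"from the random walk representations (2.50)"*; the route here (resolvent/commutator identities) is b06's declared
route (cell DIVERGENCE D-b06.21), not print's.  Nothing on d = 4 or the continuum; NOT summit progress.  Unit `lit-balaban-p38` (gen 25), 2026-08-22.
-/

namespace Literature.MathematicalPhysics.QuantumFieldTheory.Balaban1983to89.B6DomainChangeP2134

open B6DomainMajorant (cut_localInverse localInverse_cut)

section Algebra

variable {A : Type*} [Ring A]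

/-! ## §1  The differences `G − G_□`, `C − C_□` through the zone -/

/-- **`χG′ − G′χ = −G′·[χ, Δ′_a]·G′`** (`G′Δ′_a = Δ′_aG′ = 1`): the commutator of the cutoff with the global propagator passes through the zone where `χ`
varies. [cite: Balaban1984PropagatorsII, p.238 («An estimate of the terms with the commutator …»)] -/
theorem cut_comm_global {G D χ : A} (hGD : G * D = 1) (hDG : D * G = 1) : χ * G - G * χ = -(G * (χ * D - D * χ) * G) := by
  have e : G * (χ * D - D * χ) * G = G * χ * (D * G) - (G * D) * χ * G := by noncomm_ring
  rw [e, hDG, hGD, mul_one, one_mul]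
  abel

/-- **`χ·(G′ − G′_□) = G′·[χ, Δ′_a]·(G′_□ − G′)`** — the cut difference of the global and the local propagator passes through the zone (b06's
`cut_localInverse` + `cut_comm_global`). [cite: Balaban1984PropagatorsII, p.238 («connected with a change of a domain»)] -/
theorem cut_diff_left {G D Gw χ : A} (hGD : G * D = 1) (hDG : D * G = 1) (hχ : χ * D * Gw = χ) :
    χ * (G - Gw) = G * (χ * D - D * χ) * (Gw - G) := by
  rw [mul_sub χ G Gw, cut_localInverse hGD hχ]
  have e := cut_comm_global (χ := χ) hGD hDG
  have e2 : χ * G - (G * χ - G * (χ * D - D * χ) * Gw) = (χ * G - G * χ) + G * (χ * D - D * χ) * Gw := by abel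
  rw [e2, e]
  noncomm_ring

/-- **`(G′ − G′_□)·χ = (G′ − G′_□)·[χ, Δ′_a]·G′`** — mirror image (b06's `localInverse_cut`).
[cite: Balaban1984PropagatorsII, p.238 («connected with a change of a domain»)] -/
theorem diff_cut_right {G D Gw χ : A} (hGD : G * D = 1) (hDG : D * G = 1) (hχ' : Gw * D * χ = χ) :
    (G - Gw) * χ = (G - Gw) * (χ * D - D * χ) * G := by
  rw [sub_mul G Gw χ, localInverse_cut hDG hχ']
  have e := cut_comm_global (χ := χ) hGD hDG
  have e2 : G * χ - (χ * G + Gw * (χ * D - D * χ) * G) = -(χ * G - G * χ) - Gw * (χ * D - D * χ) * G := by abel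
  rw [e2, e, neg_neg, sub_mul, sub_mul]

/-- **`U·(C − C_□) = U·C_□·(B_□ − B)·C`** for a right inverse `C` of `B = Q′G′²Q′*` and a left inverse `C_□` of `B_□ = Q′G′_□²Q′*` SEEN FROM `U`
(`U·C_□·B_□ = U`: `B_□` is invertible only on the coarse functions carried by the window's blocks, and `U = G′_□Q′*` only sees those) — the
difference of the inverses passes through the difference of the squares. [cite: Balaban1984PropagatorsII, (2.17) p.225, p.238] -/
theorem inv_sub_inv {B Bw C Cw U : A} (hCw : U * Cw * Bw = U) (hBC : B * C = 1) : U * (C - Cw) = U * Cw * (Bw - B) * C := by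
  rw [mul_sub (U * Cw), sub_mul, hCw, mul_assoc (U * Cw) B C, hBC, mul_one, mul_sub]

/-- **THE TELESCOPING OF `P − P_□`**, `P = G′Q′*CQ′G′` ((2.17)), `P_□ = G′_□Q′*C_□Q′G′_□` ((2.90)): three terms with ONE difference each.
[cite: Balaban1984PropagatorsII, (2.17) p.225, (2.90)–(2.92) p.239] -/
theorem proj_telescope (G Gw Q Qt C Cw : A) :
    G * Qt * C * Q * G - Gw * Qt * Cw * Q * Gw =
      (G - Gw) * Qt * C * Q * G + Gw * Qt * (C - Cw) * Q * G + Gw * Qt * Cw * Q * (G - Gw) := by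
  noncomm_ring

/-- `G′_□² − G′² = G′_□(G′_□ − G′) + (G′_□ − G′)G′` (the split used for the middle term). [cite: Balaban1984PropagatorsII, p.238 («G′(□̃)² − G′²»)] -/
theorem sq_sub_sq_split (G Gw : A) : Gw * Gw - G * G = Gw * (Gw - G) + (Gw - G) * G := by
  noncomm_ring

/-- **THE DIFFERENCE LOCALISED BY THE CUTOFF ITSELF, left form**: `G′_□ − G′ = G′·[χ, Δ′_a]·(G′ − G′_□) + (1 − χ)·(G′_□ − G′)` — no outer cut needed:
`χ(G′_□ − G′)` passes through the commutator, `(1 − χ)(G′_□ − G′)` through the region where `χ ≠ 1`. [cite: Balaban1984PropagatorsII, p.238] -/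
theorem diff_zone_left {G D Gw χ : A} (hGD : G * D = 1) (hDG : D * G = 1) (hχ : χ * D * Gw = χ) :
    Gw - G = G * (χ * D - D * χ) * (G - Gw) + (1 - χ) * (Gw - G) := by
  have e := cut_diff_left hGD hDG hχ
  have e2 : χ * (Gw - G) = G * (χ * D - D * χ) * (G - Gw) := by
    have : χ * (Gw - G) = -(χ * (G - Gw)) := by noncomm_ring
    rw [this, e]
    noncomm_ring
  calc Gw - G = χ * (Gw - G) + (1 - χ) * (Gw - G) := by noncomm_ring
    _ = _ := by rw [e2]

/-- **THE DIFFERENCE LOCALISED BY THE CUTOFF ITSELF, right form**: `G′_□ − G′ = (G′_□ − G′)·[χ, Δ′_a]·G′ + (G′_□ − G′)·(1 − χ)`.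
[cite: Balaban1984PropagatorsII, p.238] -/
theorem diff_zone_right {G D Gw χ : A} (hGD : G * D = 1) (hDG : D * G = 1) (hχ' : Gw * D * χ = χ) :
    Gw - G = (Gw - G) * (χ * D - D * χ) * G + (Gw - G) * (1 - χ) := by
  have e := diff_cut_right hGD hDG hχ'
  have e2 : (Gw - G) * χ = (Gw - G) * (χ * D - D * χ) * G := by
    have : (Gw - G) * χ = -((G - Gw) * χ) := by noncomm_ring
    rw [this, e]
    noncomm_ring
  calc Gw - G = (Gw - G) * χ + (Gw - G) * (1 - χ) := by noncomm_ring
    _ = _ := by rw [e2]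

/-! ## §2  `cL·(P − P_□)·cR` expanded: every summand through the zone -/

/-- **THE CHANGE OF DOMAIN FOR `P` vs `P_□`, ALGEBRAIC SKELETON.**  With the global/local propagators `G′`, `G′_□` (`G′Δ′_a = Δ′_aG′ = 1`, `χΔ′_aG′_□ = χ`,
`G′_□Δ′_aχ = χ`), the averaging pair `Q′`, `Q′*`, the inverses `C` of `Q′G′²Q′*` (right, global) and `C_□` of `Q′G′_□²Q′*` (left, seen from `G′_□Q′*`:
`G′_□Q′*·C_□·Q′G′_□²Q′* = G′_□Q′*`), the cutoff `χ` with `K := χΔ′_a − Δ′_aχ` and outer factors inside the core (`cL·χ = cL`, `χ·cR = cR`):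
`cL·(G′Q′*CQ′G′ − G′_□Q′*C_□Q′G′_□)·cR` equals
`cL·G′K(G′_□ − G′)·Q′*CQ′G′·cR` (left difference)
`+ cL·G′_□Q′*C_□Q′·G′_□·(G′K(G′ − G′_□) + (1 − χ)(G′_□ − G′))·Q′*CQ′G′·cR` (middle, first half of `G′_□² − G′²`)
`+ cL·G′_□Q′*C_□Q′·((G′_□ − G′)KG′ + (G′_□ − G′)(1 − χ))·G′·Q′*CQ′G′·cR` (middle, second half)
`+ cL·G′_□Q′*C_□Q′·(G′ − G′_□)KG′·cR` (right difference) — every summand carries `K·(…)` or `(1 − χ)`, localised in the zone where `χ` varies or is not `1`.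
[cite: Balaban1984PropagatorsII, (2.92) p.239 (line 3), p.238, (2.17) p.225] -/
theorem domainChangeP_expand {G D Gw Q Qt C Cw χ cL cR : A} (hGD : G * D = 1) (hDG : D * G = 1) (hχ : χ * D * Gw = χ) (hχ' : Gw * D * χ = χ)
    (hBC : Q * G * G * Qt * C = 1) (hCw : Gw * Qt * Cw * (Q * Gw * Gw * Qt) = Gw * Qt) (hL : cL * χ = cL) (hR : χ * cR = cR) :
    cL * (G * Qt * C * Q * G - Gw * Qt * Cw * Q * Gw) * cR =
      cL * (G * (χ * D - D * χ) * (Gw - G)) * (Qt * C * Q * G) * cR +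
        cL * (Gw * Qt * Cw * Q) * (Gw * (G * (χ * D - D * χ) * (G - Gw) + (1 - χ) * (Gw - G))) * (Qt * C * Q * G) * cR +
        cL * (Gw * Qt * Cw * Q) * (((Gw - G) * (χ * D - D * χ) * G + (Gw - G) * (1 - χ)) * G) * (Qt * C * Q * G) * cR +
        cL * (Gw * Qt * Cw * Q) * ((G - Gw) * (χ * D - D * χ) * G) * cR := by
  -- the three differences through the zone
  have t1 : cL * (G - Gw) = cL * (G * (χ * D - D * χ) * (Gw - G)) := by
    calc cL * (G - Gw) = cL * χ * (G - Gw) := by rw [hL]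
      _ = cL * (χ * (G - Gw)) := mul_assoc _ _ _
      _ = _ := by rw [cut_diff_left hGD hDG hχ]
  have t3 : (G - Gw) * cR = (G - Gw) * (χ * D - D * χ) * G * cR := by
    calc (G - Gw) * cR = (G - Gw) * (χ * cR) := by rw [hR]
      _ = (G - Gw) * χ * cR := (mul_assoc _ _ _).symm
      _ = _ := by rw [diff_cut_right hGD hDG hχ']
  have t2 : Gw * Qt * (C - Cw) = Gw * Qt * Cw * (Q * (Gw * Gw - G * G) * Qt) * C := by
    rw [inv_sub_inv hCw hBC]
    noncomm_ring
  have s2 : Gw * Gw - G * G =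
      Gw * (G * (χ * D - D * χ) * (G - Gw) + (1 - χ) * (Gw - G)) + ((Gw - G) * (χ * D - D * χ) * G + (Gw - G) * (1 - χ)) * G := by
    rw [← diff_zone_left hGD hDG hχ, ← diff_zone_right hGD hDG hχ']
    exact sq_sub_sq_split G Gw
  -- assemble
  rw [proj_telescope]
  have eA : cL * ((G - Gw) * Qt * C * Q * G + Gw * Qt * (C - Cw) * Q * G + Gw * Qt * Cw * Q * (G - Gw)) * cR =
      cL * (G - Gw) * (Qt * C * Q * G) * cR + cL * (Gw * Qt * (C - Cw)) * (Q * G) * cR + cL * (Gw * Qt * Cw * Q) * ((G - Gw) * cR) := by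
    noncomm_ring
  rw [eA, t1, t3, t2, s2]
  noncomm_ring

/-- **THE SAME, SIX SUMMANDS** (the two halves of `G′_□² − G′²` distributed): with `U := G′_□Q′*C_□Q′`, `V := Q′*CQ′G′`, `K := χΔ′_a − Δ′_aχ`,
`cL·(P − P_□)·cR = cL·G′K(G′_□ − G′)·V·cR + cL·U·G′_□G′K(G′ − G′_□)·V·cR + cL·U·G′_□(1 − χ)(G′_□ − G′)·V·cR`
`+ cL·U·(G′_□ − G′)KG′G′·V·cR + cL·U·(G′_□ − G′)(1 − χ)G′·V·cR + cL·U·(G′ − G′_□)KG′·cR` — summands 1, 2, 4, 6 through the commutator `K`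
(the zone where `χ` varies), summands 3, 5 through `1 − χ` (where `χ ≠ 1`). [cite: Balaban1984PropagatorsII, (2.92) p.239 (line 3), p.238, (2.17) p.225] -/
theorem domainChangeP_expand6 {G D Gw Q Qt C Cw χ cL cR : A} (hGD : G * D = 1) (hDG : D * G = 1) (hχ : χ * D * Gw = χ) (hχ' : Gw * D * χ = χ)
    (hBC : Q * G * G * Qt * C = 1) (hCw : Gw * Qt * Cw * (Q * Gw * Gw * Qt) = Gw * Qt) (hL : cL * χ = cL) (hR : χ * cR = cR) :
    cL * (G * Qt * C * Q * G - Gw * Qt * Cw * Q * Gw) * cR =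
      cL * (G * (χ * D - D * χ) * (Gw - G)) * (Qt * C * Q * G) * cR +
        cL * (Gw * Qt * Cw * Q) * (Gw * (G * (χ * D - D * χ) * (G - Gw))) * (Qt * C * Q * G) * cR +
        cL * (Gw * Qt * Cw * Q) * (Gw * ((1 - χ) * (Gw - G))) * (Qt * C * Q * G) * cR +
        cL * (Gw * Qt * Cw * Q) * ((Gw - G) * (χ * D - D * χ) * G * G) * (Qt * C * Q * G) * cR +
        cL * (Gw * Qt * Cw * Q) * ((Gw - G) * (1 - χ) * G) * (Qt * C * Q * G) * cR +
        cL * (Gw * Qt * Cw * Q) * ((G - Gw) * (χ * D - D * χ) * G) * cR := by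
  rw [domainChangeP_expand hGD hDG hχ hχ' hBC hCw hL hR]
  noncomm_ring

end Algebra

/-! ## §3  The same in the block-majorant language of (2.51)/(2.64): the majorants of the summands add up -/

section Majorant

open B6RandomWalk (HasMajorant hasMajorant_add)

variable {g : B6.Geometry} {X : Type}

/-- **THE CHANGE OF DOMAIN FOR `P` vs `P_□` IN MAJORANT FORM, four summands**: on a fine lattice `X` with block map `blk : X → 𝔅`, operators as in
`domainChangeP_expand` (cutoff and outer factors now arbitrary endomorphisms, e.g. `mulOp χ`, `mulOp ζ_□·∂`, `∂*·mulOp h_□`); if the four zone-carrying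
summands have the `𝔅`-majorants `K₁, …, K₄` ((2.51)-shape `HasMajorant`), then `cL·(P − P_□)·cR` has the majorant `K₁ + K₂ + K₃ + K₄` — the form in which
the displayed input `hD` of `…B6Ineq2134Diag.diag_hasMajorant` / `…B6Ineq2134DiagKLevel.ineq2134_kDiag_kLevel` is fed, once each `Kᵢ` is produced from
the factors' majorants (`B6RandomWalk.hasMajorant_mul`, `…B6DomainMajorant.hasMajorant_mul_weighted`, `shape_conv_zone`) with the *"factor e^{−δ₀M}"* from the
depth of the cuts below the zone. [cite: Balaban1984PropagatorsII, (2.92) p.239 (line 3), p.238, (2.51) p.232] -/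
theorem domainChangeP_hasMajorant (blk : X → g.Site) {G D Gw Q Qt C Cw χ cL cR : Module.End ℝ (X → ℝ)} (hGD : G * D = 1) (hDG : D * G = 1)
    (hχ : χ * D * Gw = χ) (hχ' : Gw * D * χ = χ) (hBC : Q * G * G * Qt * C = 1) (hCw : Gw * Qt * Cw * (Q * Gw * Gw * Qt) = Gw * Qt)
    (hL : cL * χ = cL) (hR : χ * cR = cR) {K₁ K₂ K₃ K₄ : g.Site → g.Site → ℝ}
    (h₁ : HasMajorant blk (cL * (G * (χ * D - D * χ) * (Gw - G)) * (Qt * C * Q * G) * cR) K₁)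
    (h₂ : HasMajorant blk (cL * (Gw * Qt * Cw * Q) * (Gw * (G * (χ * D - D * χ) * (G - Gw) + (1 - χ) * (Gw - G))) * (Qt * C * Q * G) * cR) K₂)
    (h₃ : HasMajorant blk (cL * (Gw * Qt * Cw * Q) * (((Gw - G) * (χ * D - D * χ) * G + (Gw - G) * (1 - χ)) * G) * (Qt * C * Q * G) * cR) K₃)
    (h₄ : HasMajorant blk (cL * (Gw * Qt * Cw * Q) * ((G - Gw) * (χ * D - D * χ) * G) * cR) K₄) :
    HasMajorant blk (cL * (G * Qt * C * Q * G - Gw * Qt * Cw * Q * Gw) * cR) (fun a b => K₁ a b + K₂ a b + K₃ a b + K₄ a b) := by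
  rw [domainChangeP_expand hGD hDG hχ hχ' hBC hCw hL hR]
  exact hasMajorant_add blk (hasMajorant_add blk (hasMajorant_add blk h₁ h₂) h₃) h₄

/-- **THE SAME, SIX SUMMANDS** (`domainChangeP_expand6`): majorants `K₁, …, K₆` of the six zone-carrying summands add up to a majorant of
`cL·(P − P_□)·cR`. [cite: Balaban1984PropagatorsII, (2.92) p.239 (line 3), p.238, (2.51) p.232] -/
theorem domainChangeP_hasMajorant6 (blk : X → g.Site) {G D Gw Q Qt C Cw χ cL cR : Module.End ℝ (X → ℝ)} (hGD : G * D = 1) (hDG : D * G = 1)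
    (hχ : χ * D * Gw = χ) (hχ' : Gw * D * χ = χ) (hBC : Q * G * G * Qt * C = 1) (hCw : Gw * Qt * Cw * (Q * Gw * Gw * Qt) = Gw * Qt)
    (hL : cL * χ = cL) (hR : χ * cR = cR) {K₁ K₂ K₃ K₄ K₅ K₆ : g.Site → g.Site → ℝ}
    (h₁ : HasMajorant blk (cL * (G * (χ * D - D * χ) * (Gw - G)) * (Qt * C * Q * G) * cR) K₁)
    (h₂ : HasMajorant blk (cL * (Gw * Qt * Cw * Q) * (Gw * (G * (χ * D - D * χ) * (G - Gw))) * (Qt * C * Q * G) * cR) K₂)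
    (h₃ : HasMajorant blk (cL * (Gw * Qt * Cw * Q) * (Gw * ((1 - χ) * (Gw - G))) * (Qt * C * Q * G) * cR) K₃)
    (h₄ : HasMajorant blk (cL * (Gw * Qt * Cw * Q) * ((Gw - G) * (χ * D - D * χ) * G * G) * (Qt * C * Q * G) * cR) K₄)
    (h₅ : HasMajorant blk (cL * (Gw * Qt * Cw * Q) * ((Gw - G) * (1 - χ) * G) * (Qt * C * Q * G) * cR) K₅)
    (h₆ : HasMajorant blk (cL * (Gw * Qt * Cw * Q) * ((G - Gw) * (χ * D - D * χ) * G) * cR) K₆) :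
    HasMajorant blk (cL * (G * Qt * C * Q * G - Gw * Qt * Cw * Q * Gw) * cR)
      (fun a b => K₁ a b + K₂ a b + K₃ a b + K₄ a b + K₅ a b + K₆ a b) := by
  rw [domainChangeP_expand6 hGD hDG hχ hχ' hBC hCw hL hR]
  exact hasMajorant_add blk (hasMajorant_add blk (hasMajorant_add blk (hasMajorant_add blk (hasMajorant_add blk h₁ h₂) h₃) h₄) h₅) h₆

end Majorant

/-! ## §4 (v1.1)  The SANDWICH form in one ring: `S = Q′*CQ′`, `S_□ = Q′*C_□Q′` as site operators; the left-zone seven-term expansion -/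

section Sandwich

variable {A : Type*} [Ring A]

/-- **`hS1` from the global inverse**: `Q′G′²Q′*·C = 1` gives `(Q′*C_□Q′)·G′²·(Q′*CQ′) = Q′*C_□Q′`, i.e. `S_□·G′²·S = S_□` for the sandwiches
`S = Q′*CQ′`, `S_□ = Q′*C_□Q′` (stated in one ring; a consumer with rectangular `Q′` proves the same two-line computation with compositions).
[cite: Balaban1984PropagatorsII, (2.17) p.225 («(Q′G′²Q′*)⁻¹»), (2.90) p.239] -/
theorem sandwich_hyp_global {G Q Qt C Cw : A} (hBC : Q * G * G * Qt * C = 1) :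
    (Qt * Cw * Q) * (G * G) * (Qt * C * Q) = Qt * Cw * Q := by
  calc (Qt * Cw * Q) * (G * G) * (Qt * C * Q) = Qt * Cw * (Q * G * G * Qt * C) * Q := by noncomm_ring
    _ = Qt * Cw * Q := by rw [hBC, mul_one]

/-- **`hS2` from the member inverse seen from `G′_□Q′*`**: `G′_□Q′*·C_□·(Q′G′_□²Q′*) = G′_□Q′*` gives `G′_□S_□·G′_□²·S = G′_□S`.
[cite: Balaban1984PropagatorsII, (2.90) p.239 («P_□ the projection operator in (2.17) defined by the above Q′*aQ′»), (2.17) p.225] -/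
theorem sandwich_hyp_local {Gw Q Qt C Cw : A} (hCw : Gw * Qt * Cw * (Q * Gw * Gw * Qt) = Gw * Qt) :
    Gw * (Qt * Cw * Q) * (Gw * Gw) * (Qt * C * Q) = Gw * (Qt * C * Q) := by
  calc Gw * (Qt * Cw * Q) * (Gw * Gw) * (Qt * C * Q) = (Gw * Qt * Cw * (Q * Gw * Gw * Qt)) * C * Q := by noncomm_ring
    _ = Gw * (Qt * C * Q) := by rw [hCw]; noncomm_ring

/-- **the middle difference through the squares, sandwich form**: `G′_□·(S − S_□) = G′_□S_□·(G′_□² − G′²)·S` under `hS1`, `hS2` — the one-ring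
form of `inv_sub_inv` (`U(C − C_□) = UC_□(B_□ − B)C`). [cite: Balaban1984PropagatorsII, (2.17) p.225, p.238 («G′(□̃)² − G′²»)] -/
theorem sandwich_sub {G Gw S Sw : A} (hS1 : Sw * (G * G) * S = Sw) (hS2 : Gw * Sw * (Gw * Gw) * S = Gw * S) :
    Gw * (S - Sw) = Gw * Sw * (Gw * Gw - G * G) * S := by
  have e : Gw * Sw = Gw * (Sw * (G * G) * S) := by rw [hS1]
  calc Gw * (S - Sw) = Gw * S - Gw * Sw := mul_sub _ _ _
    _ = Gw * Sw * (Gw * Gw) * S - Gw * (Sw * (G * G) * S) := by rw [hS2, ← e]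
    _ = Gw * Sw * (Gw * Gw - G * G) * S := by noncomm_ring

/-- **the telescoping of `P − P_□`, sandwich form**: `G′SG′ − G′_□S_□G′_□ = (G′ − G′_□)SG′ + G′_□(S − S_□)G′ + G′_□S_□(G′ − G′_□)`.
[cite: Balaban1984PropagatorsII, (2.17) p.225, (2.90)–(2.92) p.239] -/
theorem proj_telescope_sandwich (G Gw S Sw : A) :
    G * S * G - Gw * Sw * Gw = (G - Gw) * S * G + Gw * (S - Sw) * G + Gw * Sw * (G - Gw) := by
  noncomm_ring

/-- **THE CHANGE OF DOMAIN FOR `P` vs `P_□`, SANDWICH FORM, SIX SUMMANDS** — `domainChangeP_expand6` verbatim with `Q′*CQ′G′ ↦ S·G′` and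
`G′_□Q′*C_□Q′ ↦ G′_□·S_□`, under the WEAKER inverse data `hS1 : S_□G′²S = S_□`, `hS2 : G′_□S_□G′_□²S = G′_□S` (with `K := χΔ′_a − Δ′_aχ`):
`cL·(G′SG′ − G′_□S_□G′_□)·cR = cL·G′K(G′_□ − G′)·SG′·cR + cL·G′_□S_□·G′_□G′K(G′ − G′_□)·SG′·cR + cL·G′_□S_□·G′_□(1 − χ)(G′_□ − G′)·SG′·cR`
`+ cL·G′_□S_□·(G′_□ − G′)KG′G′·SG′·cR + cL·G′_□S_□·(G′_□ − G′)(1 − χ)G′·SG′·cR + cL·G′_□S_□·(G′ − G′_□)KG′·cR`.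
[cite: Balaban1984PropagatorsII, (2.92) p.239 (line 3), p.238, (2.17) p.225] -/
theorem domainChangeP_expand6_sandwich {G D Gw S Sw χ cL cR : A} (hGD : G * D = 1) (hDG : D * G = 1) (hχ : χ * D * Gw = χ)
    (hχ' : Gw * D * χ = χ) (hS1 : Sw * (G * G) * S = Sw) (hS2 : Gw * Sw * (Gw * Gw) * S = Gw * S) (hL : cL * χ = cL)
    (hR : χ * cR = cR) :
    cL * (G * S * G - Gw * Sw * Gw) * cR =
      cL * (G * (χ * D - D * χ) * (Gw - G)) * (S * G) * cR +
        cL * (Gw * Sw) * (Gw * (G * (χ * D - D * χ) * (G - Gw))) * (S * G) * cR +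
        cL * (Gw * Sw) * (Gw * ((1 - χ) * (Gw - G))) * (S * G) * cR +
        cL * (Gw * Sw) * ((Gw - G) * (χ * D - D * χ) * G * G) * (S * G) * cR +
        cL * (Gw * Sw) * ((Gw - G) * (1 - χ) * G) * (S * G) * cR +
        cL * (Gw * Sw) * ((G - Gw) * (χ * D - D * χ) * G) * cR := by
  have t1 : cL * (G - Gw) = cL * (G * (χ * D - D * χ) * (Gw - G)) := by
    calc cL * (G - Gw) = cL * χ * (G - Gw) := by rw [hL]
      _ = cL * (χ * (G - Gw)) := mul_assoc _ _ _
      _ = _ := by rw [cut_diff_left hGD hDG hχ]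
  have t3 : (G - Gw) * cR = (G - Gw) * (χ * D - D * χ) * G * cR := by
    calc (G - Gw) * cR = (G - Gw) * (χ * cR) := by rw [hR]
      _ = (G - Gw) * χ * cR := (mul_assoc _ _ _).symm
      _ = _ := by rw [diff_cut_right hGD hDG hχ']
  have t2 := sandwich_sub hS1 hS2
  have s2 : Gw * Gw - G * G =
      Gw * (G * (χ * D - D * χ) * (G - Gw) + (1 - χ) * (Gw - G)) + ((Gw - G) * (χ * D - D * χ) * G + (Gw - G) * (1 - χ)) * G := by
    rw [← diff_zone_left hGD hDG hχ, ← diff_zone_right hGD hDG hχ']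
    exact sq_sub_sq_split G Gw
  rw [proj_telescope_sandwich]
  have eA : cL * ((G - Gw) * S * G + Gw * (S - Sw) * G + Gw * Sw * (G - Gw)) * cR =
      cL * (G - Gw) * (S * G) * cR + cL * (Gw * (S - Sw)) * G * cR + cL * (Gw * Sw) * ((G - Gw) * cR) := by
    noncomm_ring
  rw [eA, t1, t3, t2, s2]
  noncomm_ring

/-- **THE CHANGE OF DOMAIN FOR `P` vs `P_□`, LEFT-ZONE FORM, SEVEN SUMMANDS.**  Every difference `G′ − G′_□` is re-expressed by `diff_zone_left`
(`G′_□ − G′ = G′K(G′ − G′_□) + (1 − χ)(G′_□ − G′)`), so every summand carries `K·G′`, `K·G′_□` ENTERED FROM THE LEFT (`K = χΔ′_a − Δ′_aχ`, the zone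
where `χ` varies) or the factor `1 − χ` (where `χ ≠ 1`); ONLY the left cut `cL·χ = cL` and ONLY `χΔ′_aG′_□ = χ` are used (no right cut, no
`G′_□Δ′_aχ = χ`).  With `U := G′_□S_□`, `V := SG′`:
`cL·(G′SG′ − G′_□S_□G′_□) = cL·G′K(G′_□ − G′)·V + cL·U·G′_□·G′K(G′ − G′_□)·V + cL·U·G′_□·(1 − χ)(G′_□ − G′)·V + cL·U·G′K(G′ − G′_□)·G′·V`
`+ cL·U·(1 − χ)(G′_□ − G′)·G′·V + cL·U·G′K(G′_□ − G′) + cL·U·(1 − χ)(G′ − G′_□)` — the skeleton on which `…B6DomainChangeP2134Sizes` assembles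
the block-majorant sizes of line 3 of (2.92) from LEFT zone kernels only. [cite: Balaban1984PropagatorsII, (2.92) p.239 (line 3), p.238, (2.17) p.225] -/
theorem domainChangeP_expand7_left {G D Gw S Sw χ cL : A} (hGD : G * D = 1) (hDG : D * G = 1) (hχ : χ * D * Gw = χ)
    (hS1 : Sw * (G * G) * S = Sw) (hS2 : Gw * Sw * (Gw * Gw) * S = Gw * S) (hL : cL * χ = cL) :
    cL * (G * S * G - Gw * Sw * Gw) =
      cL * (G * (χ * D - D * χ) * (Gw - G)) * (S * G) +
        cL * (Gw * Sw) * (Gw * (G * (χ * D - D * χ) * (G - Gw))) * (S * G) +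
        cL * (Gw * Sw) * (Gw * ((1 - χ) * (Gw - G))) * (S * G) +
        cL * (Gw * Sw) * ((G * (χ * D - D * χ) * (G - Gw)) * G) * (S * G) +
        cL * (Gw * Sw) * (((1 - χ) * (Gw - G)) * G) * (S * G) +
        cL * (Gw * Sw) * (G * (χ * D - D * χ) * (Gw - G)) +
        cL * (Gw * Sw) * ((1 - χ) * (G - Gw)) := by
  have t1 : cL * (G - Gw) = cL * (G * (χ * D - D * χ) * (Gw - G)) := by
    calc cL * (G - Gw) = cL * χ * (G - Gw) := by rw [hL]
      _ = cL * (χ * (G - Gw)) := mul_assoc _ _ _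
      _ = _ := by rw [cut_diff_left hGD hDG hχ]
  have t2 := sandwich_sub hS1 hS2
  have dz := diff_zone_left hGD hDG hχ
  have s2 : Gw * Gw - G * G =
      Gw * (G * (χ * D - D * χ) * (G - Gw) + (1 - χ) * (Gw - G)) + (G * (χ * D - D * χ) * (G - Gw) + (1 - χ) * (Gw - G)) * G := by
    rw [← dz]
    exact sq_sub_sq_split G Gw
  have t3 : cL * (Gw * Sw) * (G - Gw) = cL * (Gw * Sw) * (G * (χ * D - D * χ) * (Gw - G) + (1 - χ) * (G - Gw)) := by
    have e : G - Gw = -(Gw - G) := by abel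
    conv_lhs => rw [e, dz]
    noncomm_ring
  rw [proj_telescope_sandwich]
  have eA : cL * ((G - Gw) * S * G + Gw * (S - Sw) * G + Gw * Sw * (G - Gw)) =
      cL * (G - Gw) * (S * G) + cL * (Gw * (S - Sw)) * G + cL * (Gw * Sw) * (G - Gw) := by
    noncomm_ring
  rw [eA, t1, t2, s2, t3]
  noncomm_ring

end Sandwich

section SandwichMajorant

open B6RandomWalk (HasMajorant hasMajorant_add)

variable {g : B6.Geometry} {X : Type}

/-- **THE LEFT-ZONE SEVEN-TERM FORM IN MAJORANT LANGUAGE**: majorants `K₁, …, K₇` of the seven summands of `domainChangeP_expand7_left` add up to a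
majorant of `cL·(P − P_□)`. [cite: Balaban1984PropagatorsII, (2.92) p.239 (line 3), p.238, (2.51) p.232] -/
theorem domainChangeP_hasMajorant7_left (blk : X → g.Site) {G D Gw S Sw χ cL : Module.End ℝ (X → ℝ)} (hGD : G * D = 1) (hDG : D * G = 1)
    (hχ : χ * D * Gw = χ) (hS1 : Sw * (G * G) * S = Sw) (hS2 : Gw * Sw * (Gw * Gw) * S = Gw * S) (hL : cL * χ = cL)
    {K₁ K₂ K₃ K₄ K₅ K₆ K₇ : g.Site → g.Site → ℝ}
    (h₁ : HasMajorant blk (cL * (G * (χ * D - D * χ) * (Gw - G)) * (S * G)) K₁)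
    (h₂ : HasMajorant blk (cL * (Gw * Sw) * (Gw * (G * (χ * D - D * χ) * (G - Gw))) * (S * G)) K₂)
    (h₃ : HasMajorant blk (cL * (Gw * Sw) * (Gw * ((1 - χ) * (Gw - G))) * (S * G)) K₃)
    (h₄ : HasMajorant blk (cL * (Gw * Sw) * ((G * (χ * D - D * χ) * (G - Gw)) * G) * (S * G)) K₄)
    (h₅ : HasMajorant blk (cL * (Gw * Sw) * (((1 - χ) * (Gw - G)) * G) * (S * G)) K₅)
    (h₆ : HasMajorant blk (cL * (Gw * Sw) * (G * (χ * D - D * χ) * (Gw - G))) K₆)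
    (h₇ : HasMajorant blk (cL * (Gw * Sw) * ((1 - χ) * (G - Gw))) K₇) :
    HasMajorant blk (cL * (G * S * G - Gw * Sw * Gw))
      (fun a b => K₁ a b + K₂ a b + K₃ a b + K₄ a b + K₅ a b + K₆ a b + K₇ a b) := by
  rw [domainChangeP_expand7_left hGD hDG hχ hS1 hS2 hL]
  exact hasMajorant_add blk (hasMajorant_add blk (hasMajorant_add blk (hasMajorant_add blk (hasMajorant_add blk
    (hasMajorant_add blk h₁ h₂) h₃) h₄) h₅) h₆) h₇

end SandwichMajorant

end Literature.MathematicalPhysics.QuantumFieldTheory.Balaban1983to89.B6DomainChangeP2134
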